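import Mathlib.AlgebraicGeometry.Sites.ElladicCohomology
import Mathlib.Topology.Instances.ZMod
import Mathlib.Topology.ContinuousMap.Algebra
import Literature.AlgebraicGeometry.Motives.EllAdicCohomologyFiniteness
import HarnessLib

/-!
# Functoriality in the coefficients and the `ℤ_ℓ`-module structure of `Hⁱ(X_proét, F_A)`

`Literature.AlgebraicGeometry.Motives.ProetCohomology X A i = Hⁱ(X_proét, F_A)`
(`EllAdicCohomologyFiniteness.lean`) is Mathlib's sheaf cohomology `Sheaf.H` (`Ext` from the
constant sheaf `ℤ`) of the pro-étale sheaf `F_A : U ↦ C(U, A)` of continuous maps to a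
topological abelian group `A` (Bhatt–Scholze, Lemma 4.2.12), lifted to `Ab.{u+1}`; for
`A = ℤ_ℓ` it is, by `rfl`, Mathlib's `Scheme.EllAdicCohomology X ℓ i` (Bhatt–Scholze
Def. 6.8.1). Mathlib provides the groups and the functoriality of `Sheaf.H` in the sheaf
(`Sheaf.H.map`, additive: `Sheaf.functorH`), but neither the functoriality of `F_A` in `A` nor
the action of the coefficient ring. This file constructs both (everything is PROVED; no named
facts):

* `continuousMapProetSheafMap X φ hφ : F_A ⟶ F_B` for a continuous additive `φ : A →+ B`
  (post-composition `g ↦ φ ∘ g`, Bhatt–Scholze Lemma 4.2.12: `T ↦ 𝓕_T` is a functor in the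
  space `T`), its lift `proetSheafMap` to `Ab.{u+1}`, and the induced
  `ProetCohomology.map X φ hφ i : Hⁱ(X_proét, F_A) →+ Hⁱ(X_proét, F_B)`, with `id`/`comp`/`add`/
  `zero` compatibilities (all by `rfl` on sections plus `Sheaf.H.map_id/comp/add`);
* `ProetCohomology.nsmul_eq_map`: the multiple `n • x` is the map induced by `n • id_A`; hence
  `Hⁱ(X_proét, F_A)` is killed by `n` whenever `A` is (`nsmul_eq_zero_of_forall`), e.g.
  `Hⁱ(X_proét, ℤ/n)` is killed by `n` (`nsmul_eq_zero_zmod`);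
* `ProetCohomology.moduleOfContinuousConstSMul`: for a topological `R`-module `A` with
  continuous homotheties, the `R`-module structure on `Hⁱ(X_proét, F_A)` in which `r` acts by
  the endomorphism induced by `a ↦ r • a` (Milne V §1, p. 176: "The ring `ℤ_l` acts on
  `Hʳ(X, F)`"; Bhatt–Scholze Def. 6.8.1: `𝓞_{E,X} = 𝓕_{𝓞_E}` is a sheaf of rings and
  `ℓ`-adic sheaves are `𝓞_E`-modules), registered as an INSTANCE only for `R = ℤ_ℓ`
  (`ProetCohomology.instModulePadicInt`), and transported by `rfl` to Mathlib's carrier as the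
  (non-instance) `ellAdicCohomologyModule X ℓ i : Module ℤ_[ℓ] (X.EllAdicCohomology ℓ i)` —
  the canonical `ℤ_ℓ`-module structure that the named facts of `EllAdicCohomologyFiniteness.lean`
  quantify over existentially.

## References

* B. Bhatt, P. Scholze, *The pro-étale topology for schemes*, Astérisque 369 (2015)
  (held: arXiv:1309.1198): Lemma 4.2.12 (p. 25 of the arXiv version), Def. 6.8.1 and
  Lemma 6.8.2 (p. 48). [BhattScholze2015]
* J. S. Milne, *Étale cohomology*, Princeton (2025 reissue, held copy; PDF pages): V §1 p. 176
  (the `ℤ_l`-action on `Hʳ(X, F)`). [Milne2025]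

## Design notes

* The general module structure is a `def` (`moduleOfContinuousConstSMul`), not an instance: with
  `R` free it would apply to `R = ℕ, ℤ` (Mathlib has `ContinuousConstSMul ℕ A` and
  `ContinuousConstSMul ℤ A` for every topological additive group) and create instance diamonds
  with `AddCommGroup.toNatModule/toIntModule` on every `ProetCohomology X A i`. The instance is
  registered for `R = ℤ_[ℓ]` only, for any topological `ℤ_ℓ`-module `A` (`ℤ_ℓ`, `ℚ_ℓ`, …).
* No instance is put on Mathlib's `Scheme.EllAdicCohomology` (CONVENTIONS §4: no instances that a
  future Mathlib instance would duplicate); `ellAdicCohomologyModule` is the `rfl`-transport, to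
  be used with `letI` or as the witness of `∃ _ : Module ℤ_[ℓ] _, …`.
* Continuity proofs are explicit arguments of the `map`s (`(φ : A →+ B) (hφ : Continuous φ)`
  rather than `ContinuousAddMonoidHom`), so that algebraic identities between the `φ`'s rewrite
  under `map_congr` without transporting structure.
* Mathlib searches: `Sheaf.H.map`, `Sheaf.H.map_id_apply`, `Sheaf.H.map_comp_apply`,
  `Sheaf.H.map_add_apply`, `Sheaf.functorH` (used); `continuousMapPresheafAb` has no `map` in the
  group variable; `AddMonoidHom.compLeftContinuous` (used). Literature: nothing on coefficients
  maps (`EllAdicCohomologyFinitenessEtale.lean` has the degree-`0` evaluation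
  `proetCohomologyZeroEquiv` only).
-/

universe u

open CategoryTheory AlgebraicGeometry

noncomputable section

namespace Literature.AlgebraicGeometry.Motives

variable (X : Scheme.{u})

section Functoriality

variable {A B C : Type} [TopologicalSpace A] [AddCommGroup A] [IsTopologicalAddGroup A]
  [TopologicalSpace B] [AddCommGroup B] [IsTopologicalAddGroup B]
  [TopologicalSpace C] [AddCommGroup C] [IsTopologicalAddGroup C]

/-- The morphism of presheaves `(U ↦ C(U, A)) ⟶ (U ↦ C(U, B))` on `Scheme` induced by a continuous
additive map `φ : A → B`: post-composition `g ↦ φ ∘ g` (Mathlib `AddMonoidHom.compLeftContinuous`).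
Naturality is definitional. [folklore] -/
@[simps]
def continuousMapPresheafAbMap (φ : A →+ B) (hφ : Continuous φ) :
    continuousMapPresheafAb.{0, u} A ⟶ continuousMapPresheafAb.{0, u} B where
  app U := AddCommGrpCat.ofHom (φ.compLeftContinuous U.unop hφ)
  naturality U V f := by
    ext g
    rfl

/-- **Functoriality of `F_A` in `A`**: the morphism of pro-étale sheaves `F_A ⟶ F_B`,
`g ↦ φ ∘ g`, induced by a continuous additive `φ : A → B` (Bhatt–Scholze Lemma 4.2.12: the sheaf
`𝓕_T : U ↦ Map_cont(U, T)` is functorial in the space `T`); the pushforward to `X_proét` of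
`continuousMapPresheafAbMap`, exactly as `continuousMapProetSheaf` is the pushforward of
`continuousMapPresheafAb`. [cite: BhattScholze2015, Lemma 4.2.12] -/
def continuousMapProetSheafMap (φ : A →+ B) (hφ : Continuous φ) :
    continuousMapProetSheaf X A ⟶ continuousMapProetSheaf X B :=
  ((Scheme.ProEt.forget X ⋙ Over.forget _).sheafPushforwardContinuous _ _
      Scheme.proetaleTopology).map ⟨continuousMapPresheafAbMap φ hφ⟩

/-- On sections over `U ∈ X_proét`, `continuousMapProetSheafMap X φ hφ` is `g ↦ φ ∘ g`
(definitional). [folklore] -/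
theorem continuousMapProetSheafMap_hom_app_apply (φ : A →+ B) (hφ : Continuous φ)
    (U : X.ProEtᵒᵖ) (g : (continuousMapProetSheaf X A).obj.obj U) :
    (continuousMapProetSheafMap X φ hφ).hom.app U g = (⟨φ, hφ⟩ : C(A, B)).comp g :=
  rfl

/-- The sheaf `F_A` lifted to `Ab.{u+1}` (composition with `AddCommGrpCat.uliftFunctor`), the
object whose `Sheaf.H` is `ProetCohomology X A` (by `rfl`; this is how Mathlib defines
`Scheme.EllAdicCohomology`). [folklore] -/
abbrev proetSheaf (A : Type) [TopologicalSpace A] [AddCommGroup A] [IsTopologicalAddGroup A] :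
    Sheaf (Scheme.ProEt.topology X) Ab.{u + 1} :=
  (sheafCompose _ AddCommGrpCat.uliftFunctor.{u + 1}).obj (continuousMapProetSheaf X A)

/-- The lift to `Ab.{u+1}` of `continuousMapProetSheafMap X φ hφ : F_A ⟶ F_B`. [folklore] -/
def proetSheafMap (φ : A →+ B) (hφ : Continuous φ) : proetSheaf X A ⟶ proetSheaf X B :=
  (sheafCompose _ AddCommGrpCat.uliftFunctor.{u + 1}).map (continuousMapProetSheafMap X φ hφ)

/-- On sections, `proetSheafMap X φ hφ` is `⟨g⟩ ↦ ⟨φ ∘ g⟩` (definitional). [folklore] -/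
theorem proetSheafMap_hom_app_apply (φ : A →+ B) (hφ : Continuous φ) (U : X.ProEtᵒᵖ)
    (g : (proetSheaf X A).obj.obj U) :
    (proetSheafMap X φ hφ).hom.app U g = ULift.up ((⟨φ, hφ⟩ : C(A, B)).comp g.down) :=
  rfl

variable {X} in
/-- `proetSheafMap` only depends on the underlying additive map. [folklore] -/
theorem proetSheafMap_congr {φ ψ : A →+ B} (h : φ = ψ) (hφ : Continuous φ) (hψ : Continuous ψ) :
    proetSheafMap X φ hφ = proetSheafMap X ψ hψ := by
  subst h
  rfl

/-- `proetSheafMap` of the identity is the identity. [folklore] -/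
theorem proetSheafMap_id (h : Continuous (AddMonoidHom.id A)) :
    proetSheafMap X (AddMonoidHom.id A) h = 𝟙 _ := by
  ext U g
  rfl

/-- `proetSheafMap` of a composite is the composite. [folklore] -/
theorem proetSheafMap_comp (φ : A →+ B) (hφ : Continuous φ) (ψ : B →+ C) (hψ : Continuous ψ)
    (h : Continuous (ψ.comp φ)) :
    proetSheafMap X (ψ.comp φ) h = proetSheafMap X φ hφ ≫ proetSheafMap X ψ hψ := by
  ext U g
  rfl

/-- `proetSheafMap` of a sum is the sum (the sheaf category is preadditive, sections-wise).
[folklore] -/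
theorem proetSheafMap_add (φ ψ : A →+ B) (hφ : Continuous φ) (hψ : Continuous ψ)
    (h : Continuous (φ + ψ)) :
    proetSheafMap X (φ + ψ) h = proetSheafMap X φ hφ + proetSheafMap X ψ hψ := by
  ext U g
  rfl

/-- `proetSheafMap` of `0` is `0`. [folklore] -/
theorem proetSheafMap_zero (h : Continuous (0 : A →+ B)) :
    proetSheafMap X (0 : A →+ B) h = 0 := by
  ext U g
  rfl

namespace ProetCohomology

/-- **Functoriality of `Hⁱ(X_proét, F_A)` in the coefficients**: the homomorphism
`Hⁱ(X_proét, F_A) →+ Hⁱ(X_proét, F_B)` induced by a continuous additive `φ : A → B`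
(Mathlib `Sheaf.H.map` of `proetSheafMap X φ hφ`). [folklore] -/
def map (φ : A →+ B) (hφ : Continuous φ) (i : ℕ) :
    ProetCohomology X A i →+ ProetCohomology X B i :=
  Sheaf.H.map (proetSheafMap X φ hφ) i

/-- Unfolding of `ProetCohomology.map` to `Sheaf.H.map` (definitional). [folklore] -/
theorem map_apply (φ : A →+ B) (hφ : Continuous φ) (i : ℕ) (x : ProetCohomology X A i) :
    map X φ hφ i x = Sheaf.H.map (proetSheafMap X φ hφ) i x :=
  rfl

variable {X} in
/-- `ProetCohomology.map` only depends on the underlying additive map. [folklore] -/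
theorem map_congr {φ ψ : A →+ B} (h : φ = ψ) (hφ : Continuous φ) (hψ : Continuous ψ) (i : ℕ)
    (x : ProetCohomology X A i) : map X φ hφ i x = map X ψ hψ i x := by
  subst h
  rfl

/-- The identity induces the identity. [folklore] -/
@[simp]
theorem map_id (h : Continuous (AddMonoidHom.id A)) (i : ℕ) (x : ProetCohomology X A i) :
    map X (AddMonoidHom.id A) h i x = x := by
  rw [map_apply, proetSheafMap_id, Sheaf.H.map_id_apply]

/-- A composite induces the composite. [folklore] -/
theorem map_comp (φ : A →+ B) (hφ : Continuous φ) (ψ : B →+ C) (hψ : Continuous ψ)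
    (h : Continuous (ψ.comp φ)) (i : ℕ) (x : ProetCohomology X A i) :
    map X (ψ.comp φ) h i x = map X ψ hψ i (map X φ hφ i x) := by
  rw [map_apply, proetSheafMap_comp X φ hφ ψ hψ, Sheaf.H.map_comp_apply]
  rfl

/-- A sum induces the sum (`Sheaf.H.map` is additive in the morphism). [folklore] -/
theorem map_add' (φ ψ : A →+ B) (hφ : Continuous φ) (hψ : Continuous ψ)
    (h : Continuous (φ + ψ)) (i : ℕ) (x : ProetCohomology X A i) :
    map X (φ + ψ) h i x = map X φ hφ i x + map X ψ hψ i x := by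
  rw [map_apply, proetSheafMap_add X φ ψ hφ hψ, Sheaf.H.map_add_apply]
  rfl

/-- The zero map induces zero. [folklore] -/
@[simp]
theorem map_zero' (h : Continuous (0 : A →+ B)) (i : ℕ) (x : ProetCohomology X A i) :
    map X (0 : A →+ B) h i x = 0 := by
  rw [map_apply, proetSheafMap_zero]
  have : x.comp (Abelian.Ext.mk₀ (0 : proetSheaf X A ⟶ proetSheaf X B)) (add_zero i) = 0 := by
    simp
  exact this

/-- The multiple `n • x` of a class is the class pushed forward along `n • id_A : A → A`
(induction on `n` from `map_add'`, `map_id`, `map_zero'`). [folklore] -/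
theorem nsmul_eq_map (n : ℕ) (h : Continuous (n • AddMonoidHom.id A)) (i : ℕ)
    (x : ProetCohomology X A i) : n • x = map X (n • AddMonoidHom.id A) h i x := by
  induction n with
  | zero => rw [zero_nsmul, map_congr (zero_nsmul _) h continuous_const, map_zero']
  | succ n ih =>
    rw [succ_nsmul, ih ((continuous_nsmul n).comp continuous_id), map_congr (succ_nsmul _ n)
      h (((continuous_nsmul n).comp continuous_id).add continuous_id), map_add' X _ _
      ((continuous_nsmul n).comp continuous_id) continuous_id, map_id]

/-- If the coefficient group `A` is killed by `n`, so is `Hⁱ(X_proét, F_A)`. [folklore] -/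
theorem nsmul_eq_zero_of_forall (n : ℕ) (hn : ∀ a : A, n • a = 0) (i : ℕ)
    (x : ProetCohomology X A i) : n • x = 0 := by
  have h0 : n • AddMonoidHom.id A = 0 := by
    ext a
    exact hn a
  rw [nsmul_eq_map X n ((continuous_nsmul n).comp continuous_id) i x, map_congr h0 _
    continuous_const, map_zero']

/-- `Hⁱ(X_proét, ℤ/n)` is killed by `n` (for `n = ℓᵐ`: it is a `ℤ/ℓᵐ`-module, cf. Milne V §1,
p. 176, "`F_n` is killed by `lⁿ`"). [folklore] -/
theorem nsmul_eq_zero_zmod (n i : ℕ) (x : ProetCohomology X (ZMod n) i) : n • x = 0 :=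
  nsmul_eq_zero_of_forall X n (fun a => by simp) i x

section Module

variable (R : Type*) [Semiring R] [Module R A] [ContinuousConstSMul R A]

/-- **The `R`-module structure on `Hⁱ(X_proét, F_A)`** for a topological `R`-module `A` with
continuous homotheties: `r` acts by the endomorphism induced by the continuous additive map
`a ↦ r • a` (`DistribSMul.toAddMonoidHom A r`); the axioms follow from the functoriality lemmas
above. For `R = A = ℤ_ℓ` this is the action of Milne V §1 (p. 176), "The ring `ℤ_l` acts on
`Hʳ(X, F)`", transcribed to the pro-étale sheaf `𝓞_{ℚ_ℓ,X} = 𝓕_{ℤ_ℓ}` of Bhatt–Scholze Def. 6.8.1.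
A `def`, not an instance (see the design notes: `R = ℕ, ℤ` would create diamonds).
[cite: Milne2025, V §1 (p. 176)] -/
abbrev moduleOfContinuousConstSMul (i : ℕ) : Module R (ProetCohomology X A i) where
  smul r x := map X (DistribSMul.toAddMonoidHom A r) (continuous_const_smul r) i x
  one_smul x := by
    change map X _ _ i x = x
    rw [map_congr (ψ := AddMonoidHom.id A) (by ext; simp) _ continuous_id, map_id]
  mul_smul r s x := by
    change map X _ _ i x = map X _ _ i (map X _ _ i x)
    rw [← map_comp]
    · exact map_congr (by ext; simp [mul_smul]) _ _ _ _
    · exact (continuous_const_smul r).comp (continuous_const_smul s)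
  smul_zero r := by
    change map X _ _ i 0 = 0
    exact map_zero _
  smul_add r x y := by
    change map X _ _ i (x + y) = map X _ _ i x + map X _ _ i y
    exact map_add _ x y
  add_smul r s x := by
    change map X _ _ i x = map X _ _ i x + map X _ _ i x
    rw [← map_add']
    · exact map_congr (by ext; simp [add_smul]) _ _ _ _
    · exact (continuous_const_smul r).add (continuous_const_smul s)
  zero_smul x := by
    change map X _ _ i x = 0
    rw [map_congr (ψ := (0 : A →+ A)) (by ext; simp) _ continuous_const, map_zero']

end Module

end ProetCohomology

end Functoriality

/-! ### `ℤ_ℓ`-modules -/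

section PadicInt

variable (ℓ : ℕ) [Fact ℓ.Prime]

variable {A : Type} [TopologicalSpace A] [AddCommGroup A] [IsTopologicalAddGroup A]
  [Module ℤ_[ℓ] A] [ContinuousConstSMul ℤ_[ℓ] A]

/-- **The canonical `ℤ_ℓ`-module structure on `Hⁱ(X_proét, F_A)`** for a topological
`ℤ_ℓ`-module `A` (in particular on `Hⁱ(X_proét, ℤ_ℓ)`, `Hⁱ(X_proét, ℚ_ℓ)`):
`ProetCohomology.moduleOfContinuousConstSMul` registered as an instance for the scalar ring
`ℤ_ℓ` (Milne V §1, p. 176; Bhatt–Scholze Def. 6.8.1). [cite: Milne2025, V §1 (p. 176)] -/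
instance ProetCohomology.instModulePadicInt (i : ℕ) : Module ℤ_[ℓ] (ProetCohomology X A i) :=
  ProetCohomology.moduleOfContinuousConstSMul X ℤ_[ℓ] i

/-- Unfolding of the `ℤ_ℓ`-action: `r • x` is the class pushed forward along `a ↦ r • a`
(definitional). [folklore] -/
theorem ProetCohomology.smul_def (i : ℕ) (r : ℤ_[ℓ]) (x : ProetCohomology X A i) :
    r • x = ProetCohomology.map X (DistribSMul.toAddMonoidHom A r)
      (continuous_const_smul r) i x :=
  rfl

/-- **The canonical `ℤ_ℓ`-module structure on Mathlib's `Hⁱ_proét(X, ℤ_ℓ)`**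
(`Scheme.EllAdicCohomology X ℓ i`, which is `ProetCohomology X ℤ_[ℓ] i` by `rfl`): the transport
of `ProetCohomology.instModulePadicInt`. Deliberately not an instance; use with `letI` or as the
witness in `∃ _ : Module ℤ_[ℓ] (X.EllAdicCohomology ℓ i), …`. [cite: Milne2025, V §1 (p. 176)] -/
abbrev ellAdicCohomologyModule (i : ℕ) : Module ℤ_[ℓ] (X.EllAdicCohomology ℓ i) :=
  inferInstanceAs (Module ℤ_[ℓ] (ProetCohomology X ℤ_[ℓ] i))

end PadicInt

end Literature.AlgebraicGeometry.Motives

end
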